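import Mathlib
import Literature.Computability.AlgebraicComplexity.SimultaneousDoubleProduct

/-!
# The chart pattern lemma of the rotated SDPP chart — stub `stub_chartPattern` of line
`registered` (crux `EisensteinValCertificates.HomocyclicSTPPDesigns`, stmt-MatrixMultiplication-10647)

The clustered-charts line turns an SDPP family `(A_t, B_t)_{t<n}` in `ℤ/p` (tree `IsSDPP`,
Cohn–Kleinberg–Szegedy–Umans 2005, §4 Def. 4.1) into STPP designs through CKSU's chart USPs: the
chart symbols are `(t, r) ∈ Fin n × Fin 3`, the pair `(A_t, B_t)` appearing in the three rotated
roles `r = 0 : (A_t, B_t, {0})`, `r = 1 : ({0}, A_t, B_t)`, `r = 2 : (B_t, {0}, A_t)`, and the chart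
hypergraph excludes the symbol triple `(x, y, z)` exactly when
`0 ∈ (𝔄 x − 𝔄 y) + (𝔅 y − 𝔅 z) + (ℭ z − ℭ x)`.

This file proves the PATTERN LEMMA: for three symbols `(t₁, r)`, `(t₂, r)`, `(t₃, r)` of the SAME
role `r`, the relation set contains `0` only if two of the indices coincide and the two relevant
diagonal difference sets `D_t = A_t − B_t` meet:

* role 0: `0 ∈ (A t₁ − A t₂) + (B t₂ − B t₃) + ({0} − {0}) → t₁ = t₃ ∧ D t₁ ∩ D t₂ ≠ ∅`;
* role 1: `0 ∈ ({0} − {0}) + (A t₂ − A t₃) + (B t₃ − B t₁) → t₂ = t₁ ∧ D t₂ ∩ D t₃ ≠ ∅`;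
* role 2: `0 ∈ (B t₁ − B t₂) + ({0} − {0}) + (A t₃ − A t₁) → t₃ = t₂ ∧ D t₃ ∩ D t₁ ≠ ∅`.

Proof: each hypothesis unpacks (`Finset.mem_add`, `Finset.mem_sub`, `{0} − {0} = {0}`) to a
relation `(a − a') + (b − b') = 0` with `a ∈ A i`, `a' ∈ A j`, `b ∈ B j`, `b' ∈ B k` for the
appropriate rotation `(i, j, k)` of the indices; clause (X) of the SDPP (`IsSDPP.simultaneous`) gives
`i = k`, and then `a − b' = a' − b` lies in both `A i − B i` (as `B k = B i`) and `A j − B j`.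

Sources: H. Cohn, R. Kleinberg, B. Szegedy, C. Umans, *Group-theoretic algorithms for matrix
multiplication*, FOCS 2005, §4 Def. 4.1 (the SDPP and its reformulation by difference sets) and
§6.2 (the rotated three-role construction).  Not here: the chart-USP rows, the designs built from
them, or any SDPP family — those are the other stubs of the line.
-/

set_option linter.dupNamespace false
-- (single-conjunct summit: the namespace repeats `MatrixMultiplication`)

namespace Summit.MatrixMultiplication.MatrixMultiplication.Theorems.HomocyclicSTPPDesigns.ClusteredCharts

open Literature.Computability.AlgebraicComplexity
open scoped Pointwise

/-- The common core of the three roles: in an SDPP family, a relation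
`(a - a') + (b - b') = 0` with `a ∈ A i`, `a' ∈ A j`, `b ∈ B j`, `b' ∈ B k` forces `i = k`
(clause (X)), and then the element `a - b' = a' - b` witnesses that the diagonal difference sets
`A i - B i` and `A j - B j` are not disjoint. [cite: CohnKleinbergSzegedyUmans2005, §4 Def. 4.1] -/
private theorem chartPattern_core {H : Type*} [AddCommGroup H] [DecidableEq H] {n : ℕ}
    {A B : Fin n → Finset H} (hS : IsSDPP A B) {i j k : Fin n} {a a' b b' : H}
    (ha : a ∈ A i) (ha' : a' ∈ A j) (hb : b ∈ B j) (hb' : b' ∈ B k)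
    (h0 : (a - a') + (b - b') = 0) : i = k ∧ ¬ Disjoint (A i - B i) (A j - B j) := by
  have hik : i = k := hS.simultaneous ha ha' hb hb' h0
  refine ⟨hik, ?_⟩
  rw [Finset.not_disjoint_iff]
  have hb'i : b' ∈ B i := by
    rw [hik]
    exact hb'
  refine ⟨a - b', Finset.sub_mem_sub ha hb'i, ?_⟩
  have he : a - b' = a' - b := by
    rw [← sub_eq_zero, ← h0]
    abel
  rw [he]
  exact Finset.sub_mem_sub ha' hb

/-- **Chart pattern lemma** (registered stub `stub_chartPattern` of line `registered`): for an SDPP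
family `(A_t, B_t)_{t<n}` in `ℤ/p` and indices `t₁ t₂ t₃`, each of the three same-role instances
of the chart relation `0 ∈ (𝔄 x − 𝔄 y) + (𝔅 y − 𝔅 z) + (ℭ z − ℭ x)` — role 0 `(A, B, {0})`,
role 1 `({0}, A, B)`, role 2 `(B, {0}, A)` — forces two of the indices to coincide and the two
corresponding diagonal difference sets `A_t − B_t` to meet.  It is clause (X) of the SDPP
(Cohn–Kleinberg–Szegedy–Umans 2005, §4 Def. 4.1) applied to the three rotations of `(t₁, t₂, t₃)`.
[cite: CohnKleinbergSzegedyUmans2005, §4 Def. 4.1] -/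
theorem stub_chartPattern :
    ∀ (p n : ℕ) (A B : Fin n → Finset (ZMod p)), IsSDPP A B → ∀ t₁ t₂ t₃ : Fin n,
      ((0 : ZMod p) ∈ (A t₁ - A t₂) + (B t₂ - B t₃) + (({0} : Finset (ZMod p)) - {0}) →
          t₁ = t₃ ∧ ¬ Disjoint (A t₁ - B t₁) (A t₂ - B t₂)) ∧
      ((0 : ZMod p) ∈ (({0} : Finset (ZMod p)) - {0}) + (A t₂ - A t₃) + (B t₃ - B t₁) →
          t₂ = t₁ ∧ ¬ Disjoint (A t₂ - B t₂) (A t₃ - B t₃)) ∧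
      ((0 : ZMod p) ∈ (B t₁ - B t₂) + (({0} : Finset (ZMod p)) - {0}) + (A t₃ - A t₁) →
          t₃ = t₂ ∧ ¬ Disjoint (A t₃ - B t₃) (A t₁ - B t₁)) := by
  intro p n A B hS t₁ t₂ t₃
  -- the degenerate third summand `{0} - {0} = {0}` only contributes `0`
  have h00 : ∀ z : ZMod p, z ∈ (({0} : Finset (ZMod p)) - {0}) → z = 0 := by
    intro z hz
    rw [Finset.singleton_sub_singleton, sub_zero, Finset.mem_singleton] at hz
    exact hz
  refine ⟨fun h => ?_, fun h => ?_, fun h => ?_⟩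
  · -- role 0: `0 = ((a - a') + (b - b')) + z` with `a ∈ A t₁, a' ∈ A t₂, b ∈ B t₂, b' ∈ B t₃`
    obtain ⟨x, hx, z, hz, hxz⟩ := Finset.mem_add.1 h
    obtain ⟨u, hu, v, hv, rfl⟩ := Finset.mem_add.1 hx
    obtain ⟨a, ha, a', ha', rfl⟩ := Finset.mem_sub.1 hu
    obtain ⟨b, hb, b', hb', rfl⟩ := Finset.mem_sub.1 hv
    rw [h00 z hz, add_zero] at hxz
    exact chartPattern_core hS ha ha' hb hb' hxz
  · -- role 1: `0 = (z + (a - a')) + (b - b')` with `a ∈ A t₂, a' ∈ A t₃, b ∈ B t₃, b' ∈ B t₁`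
    obtain ⟨x, hx, v, hv, hxv⟩ := Finset.mem_add.1 h
    obtain ⟨z, hz, u, hu, rfl⟩ := Finset.mem_add.1 hx
    obtain ⟨a, ha, a', ha', rfl⟩ := Finset.mem_sub.1 hu
    obtain ⟨b, hb, b', hb', rfl⟩ := Finset.mem_sub.1 hv
    rw [h00 z hz, zero_add] at hxv
    exact chartPattern_core hS ha ha' hb hb' hxv
  · -- role 2: `0 = ((b - b') + z) + (a - a')` with `b ∈ B t₁, b' ∈ B t₂, a ∈ A t₃, a' ∈ A t₁`
    obtain ⟨x, hx, u, hu, hxu⟩ := Finset.mem_add.1 h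
    obtain ⟨v, hv, z, hz, rfl⟩ := Finset.mem_add.1 hx
    obtain ⟨b, hb, b', hb', rfl⟩ := Finset.mem_sub.1 hv
    obtain ⟨a, ha, a', ha', rfl⟩ := Finset.mem_sub.1 hu
    rw [h00 z hz, add_zero, add_comm] at hxu
    exact chartPattern_core hS ha ha' hb hb' hxu

end Summit.MatrixMultiplication.MatrixMultiplication.Theorems.HomocyclicSTPPDesigns.ClusteredCharts
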